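import Mathlib
import Summits.NavierStokesRegularity.NavierStokesRegularity.Theorems.FilamentSkeletonRssKelvinGateSharpGateSpec

/-!
# Route `FilamentSkeletonRss` · crux `TransverseReduction1AG` (stmt-27853; asides 27414 / 21221) — line `kelvin_gate_sharp`:
# THE CONTINUITY METHOD IN THE SHARP SCALES — a Kelvin gate at a LARGE base from a UNIFORM A-PRIORI BOUND

Helper file (one definition `SharpApriori` + theorems, `--as helper`).  HONEST FRAMING: linear bookkeeping for a HYPOTHETICAL
filament-type rotating-self-similar blow-up route (MODEL rung, negative side); nothing here bears on Navier–Stokes regularity; no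
stub is proved; `TransverseReduction1AG` is neither proved nor refuted.

`SharpGateSpec.perturb` (p638207): gates are OPEN in the base — bound `A` at `U⁰`, `C²` increment of weighted size `M`, `8AM ≤ 1`
⇒ bound `2A` at `U⁰ + V`.  Iterated naively the bound doubles per step and an `O(Γ)` base is out of reach (memo FREE-GATE-SHARP-21221-g8
§8).  Here is the other half of the continuity method.  With the UNIFORM A-PRIORI BOUND along the segment `U⁰ + tV`, `t ∈ [0,1]`,
  `SharpApriori a B α U` : every `W ∈ X♯_a` (div-free), `Q ∈ C¹` bounded with `𝓛_(α,U) W + ∇Q = F ∈ Y♯_a(R)` has `W ∈ X♯_a(BR)`,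
a sharp gate at `U⁰` (bound `A₀`) propagates to a sharp gate at `U⁰ + V` with bound `max B (A₀(1 + 4MB))` — POLYNOMIAL in
`(A₀, B, M)`, increments of ANY size (`sharp_gate_continuation`); with the free gate (`sharpGateSpec_free`): **a sharp Kelvin gate
exists at every `C²` base along whose ray the a-priori bound holds, bound `max B (C(a)(1+4MB))`, every rate** (`sharp_gate_of_apriori`).
So stub S2′ (`EventualSharpGate1A(G)`) REDUCES to a uniform ESTIMATE along the ray of the dressed base; the estimate (Kelvin-mode
analysis of the `O(Γ)` column) is the crux and is NOT here.  Converse: gate + uniqueness ⇒ a-priori bound (`apriori_of_unique`).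

Mechanism: (i) a-priori bound ⇒ UNIQUENESS in the class (`SharpApriori.eq_of_solutions`; datum `0 ∈ Y♯_a(0)`); (ii) RENORMALISATION
(`SharpGateSpec.renorm`): any gate `(K′, 𝒬′)` at `U⁰ + V′` has velocity bound `B`, and pressure `𝒬₀(F − (D(K′F)[V′] + DV′[K′F]))`
through the ORIGINAL gate — `K′F` and `K₀(F − …)` solve the same equation at `U⁰` (`lerayLin_add_base`), so coincide — with bound
`A₀(1 + 4M′B)`; (iii) `n = ⌈8A⋆M⌉₊ + 1` equal steps of `perturb`, `A⋆ := max B (A₀(1+4MB))`, renormalised each time, stay at `A⋆`.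
-/


set_option linter.dupNamespace false

noncomputable section

namespace Summit.NavierStokesRegularity.NavierStokesRegularity.Theorems.KelvinGate

open Set Function Filter MeasureTheory
open Literature.Analysis.FluidPDE
open scoped InnerProductSpace Laplacian ContDiff Topology BigOperators

/-! ## Algebra of the sharp X-scale (sums, scalar multiples, differences) -/

section XAlgebra

variable {a : ℝ} {W W₁ W₂ : EuclideanSpace ℝ (Fin 3) → EuclideanSpace ℝ (Fin 3)} {R R₁ R₂ : ℝ}

/-- `‖c • L‖ = |c| ‖L‖` for second-derivative-valued maps (the `NormSMulClass` instance on the curried operator space is not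
found by instance synthesis; we name it). -/
theorem norm_smul_clm2 (c : ℝ)
    (L : EuclideanSpace ℝ (Fin 3) →L[ℝ] EuclideanSpace ℝ (Fin 3) →L[ℝ] EuclideanSpace ℝ (Fin 3)) :
    ‖c • L‖ = |c| * ‖L‖ := by
  rw [@norm_smul ℝ _ _ _ _ NormedSpace.toNormSMulClass c L, Real.norm_eq_abs]

/-- For a `C²` field, `fderiv` is differentiable. -/
theorem XSharp.differentiableAt_fderiv (h : XSharp a W R) (y : EuclideanSpace ℝ (Fin 3)) :
    DifferentiableAt ℝ (fderiv ℝ W) y :=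
  ((h.1.fderiv_right (m := 1) le_rfl).differentiable (by norm_num)) y

/-- **The sharp X-scale is closed under addition**: radii add. -/
theorem XSharp.add (h₁ : XSharp a W₁ R₁) (h₂ : XSharp a W₂ R₂) : XSharp a (fun y => W₁ y + W₂ y) (R₁ + R₂) := by
  have hd₁ : Differentiable ℝ W₁ := h₁.1.differentiable (by norm_num)
  have hd₂ : Differentiable ℝ W₂ := h₂.1.differentiable (by norm_num)
  have hD : fderiv ℝ (fun y => W₁ y + W₂ y) = fun y => fderiv ℝ W₁ y + fderiv ℝ W₂ y := by
    funext y; exact fderiv_fun_add (hd₁ y) (hd₂ y)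
  refine ⟨h₁.1.add h₂.1, fun y => ⟨?_, ?_, ?_⟩⟩
  · calc (1 + ‖y‖) * ‖W₁ y + W₂ y‖ ≤ (1 + ‖y‖) * (‖W₁ y‖ + ‖W₂ y‖) :=
          mul_le_mul_of_nonneg_left (norm_add_le _ _) (by positivity)
      _ ≤ R₁ + R₂ := by rw [mul_add]; exact add_le_add (h₁.2 y).1 (h₂.2 y).1
  · rw [hD]
    calc (1 + ‖y‖) ^ a * ‖fderiv ℝ W₁ y + fderiv ℝ W₂ y‖ ≤ (1 + ‖y‖) ^ a * (‖fderiv ℝ W₁ y‖ + ‖fderiv ℝ W₂ y‖) :=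
          mul_le_mul_of_nonneg_left (norm_add_le _ _) (by positivity)
      _ ≤ R₁ + R₂ := by rw [mul_add]; exact add_le_add (h₁.2 y).2.1 (h₂.2 y).2.1
  · rw [hD, fderiv_fun_add (h₁.differentiableAt_fderiv y) (h₂.differentiableAt_fderiv y)]
    calc (1 + ‖y‖) ^ a * ‖fderiv ℝ (fderiv ℝ W₁) y + fderiv ℝ (fderiv ℝ W₂) y‖
          ≤ (1 + ‖y‖) ^ a * (‖fderiv ℝ (fderiv ℝ W₁) y‖ + ‖fderiv ℝ (fderiv ℝ W₂) y‖) :=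
          mul_le_mul_of_nonneg_left (norm_add_le (fderiv ℝ (fderiv ℝ W₁) y) (fderiv ℝ (fderiv ℝ W₂) y)) (by positivity)
      _ ≤ R₁ + R₂ := by rw [mul_add]; exact add_le_add (h₁.2 y).2.2 (h₂.2 y).2.2

/-- **The sharp X-scale is closed under scalar multiplication**: the radius scales by `|c|`. -/
theorem XSharp.smul (h : XSharp a W R) (c : ℝ) : XSharp a (fun y => c • W y) (|c| * R) := by
  have hd : Differentiable ℝ W := h.1.differentiable (by norm_num)
  have hD : fderiv ℝ (fun y => c • W y) = fun y => c • fderiv ℝ W y := by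
    funext y; exact fderiv_fun_const_smul (hd y) c
  refine ⟨h.1.const_smul c, fun y => ⟨?_, ?_, ?_⟩⟩
  · rw [norm_smul, Real.norm_eq_abs, mul_left_comm]
    exact mul_le_mul_of_nonneg_left (h.2 y).1 (abs_nonneg c)
  · rw [hD, norm_smul, Real.norm_eq_abs, mul_left_comm]
    exact mul_le_mul_of_nonneg_left (h.2 y).2.1 (abs_nonneg c)
  · rw [hD, fderiv_fun_const_smul (h.differentiableAt_fderiv y) c, norm_smul_clm2, mul_left_comm]
    exact mul_le_mul_of_nonneg_left (h.2 y).2.2 (abs_nonneg c)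

/-- Differences in the sharp X-scale. -/
theorem XSharp.sub (h₁ : XSharp a W₁ R₁) (h₂ : XSharp a W₂ R₂) : XSharp a (fun y => W₁ y - W₂ y) (R₁ + R₂) := by
  have h := h₁.add (h₂.smul (-1))
  simp only [neg_smul, one_smul, abs_neg, abs_one, one_mul, ← sub_eq_add_neg] at h
  exact h

/-- A sharp X-bound of radius `≤ 0` forces the zero field. -/
theorem XSharp.eq_zero_of_nonpos (h : XSharp a W R) (hR : R ≤ 0) : W = fun _ => 0 := by
  funext y
  have h1 : (1 + ‖y‖) * ‖W y‖ ≤ 0 := (h.2 y).1.trans hR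
  have h2 : ‖W y‖ ≤ 0 := by
    by_contra hlt
    push Not at hlt
    exact absurd h1 (not_le.mpr (mul_pos (by positivity) hlt))
  exact norm_le_zero_iff.mp h2

end XAlgebra

/-! ## Small pointwise calculus -/

/-- `∇(P − Q)(y) = ∇P(y) − ∇Q(y)` at points where both scalars are differentiable. -/
theorem gradient_fun_sub' {P Q : EuclideanSpace ℝ (Fin 3) → ℝ} {y : EuclideanSpace ℝ (Fin 3)}
    (hP : DifferentiableAt ℝ P y) (hQ : DifferentiableAt ℝ Q y) :
    gradient (fun z => P z - Q z) y = gradient P y - gradient Q y := by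
  simp only [gradient, fderiv_fun_sub hP hQ, map_sub]

/-- Differences of differentiable divergence-free fields are divergence free. -/
theorem isDivFree_fun_sub {W₁ W₂ : EuclideanSpace ℝ (Fin 3) → EuclideanSpace ℝ (Fin 3)}
    (h₁ : VectorCalculus.IsDivFree W₁) (h₂ : VectorCalculus.IsDivFree W₂)
    (hd₁ : Differentiable ℝ W₁) (hd₂ : Differentiable ℝ W₂) :
    VectorCalculus.IsDivFree (fun y => W₁ y - W₂ y) := by
  intro x
  have e1 := h₁ x
  have e2 := h₂ x
  simp only [VectorCalculus.divergence] at e1 e2 ⊢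
  rw [fderiv_fun_sub (hd₁ x) (hd₂ x)]
  simp [map_sub, e1, e2]

/-- `𝓛_(α,U⁰)` is additive-with-sign in `W` at `C²` points: `𝓛(W₁ − W₂) = 𝓛W₁ − 𝓛W₂`. -/
theorem lerayLin_fun_sub (α : ℝ) (U0 : EuclideanSpace ℝ (Fin 3) → EuclideanSpace ℝ (Fin 3))
    {W₁ W₂ : EuclideanSpace ℝ (Fin 3) → EuclideanSpace ℝ (Fin 3)} {y : EuclideanSpace ℝ (Fin 3)}
    (h₁ : ContDiffAt ℝ 2 W₁ y) (h₂ : ContDiffAt ℝ 2 W₂ y) :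
    lerayLin α U0 (fun z => W₁ z - W₂ z) y = lerayLin α U0 W₁ y - lerayLin α U0 W₂ y := by
  have e : (fun z => W₁ z - W₂ z) = fun z => W₁ z + (-1:ℝ) • W₂ z := by
    funext z; simp [sub_eq_add_neg]
  rw [e, lerayLin_add_smul α (-1) U0 W₁ W₂ y h₁ h₂]
  simp [sub_eq_add_neg]

/-- Weighted sizes of a scalar multiple of a base increment: `⟨y⟩‖cV‖, ⟨y⟩²‖D(cV)‖, ⟨y⟩³‖D²(cV)‖ ≤ |c| M`, and `cV ∈ C²`. -/
theorem baseIncrement_smul {V : EuclideanSpace ℝ (Fin 3) → EuclideanSpace ℝ (Fin 3)} {M : ℝ}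
    (hV : ContDiff ℝ 2 V) (hV0 : ∀ y, (1 + ‖y‖) * ‖V y‖ ≤ M)
    (hV1 : ∀ y, (1 + ‖y‖) ^ 2 * ‖fderiv ℝ V y‖ ≤ M) (hV2 : ∀ y, (1 + ‖y‖) ^ 3 * ‖fderiv ℝ (fderiv ℝ V) y‖ ≤ M) (c : ℝ) :
    ContDiff ℝ 2 (fun z => c • V z) ∧ (∀ y, (1 + ‖y‖) * ‖c • V y‖ ≤ |c| * M) ∧
      (∀ y, (1 + ‖y‖) ^ 2 * ‖fderiv ℝ (fun z => c • V z) y‖ ≤ |c| * M) ∧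
      (∀ y, (1 + ‖y‖) ^ 3 * ‖fderiv ℝ (fderiv ℝ (fun z => c • V z)) y‖ ≤ |c| * M) := by
  have hd : Differentiable ℝ V := hV.differentiable (by norm_num)
  have hdD : Differentiable ℝ (fderiv ℝ V) := (hV.fderiv_right (m := 1) le_rfl).differentiable (by norm_num)
  have hD : fderiv ℝ (fun z => c • V z) = fun y => c • fderiv ℝ V y := by
    funext y; exact fderiv_fun_const_smul (hd y) c
  refine ⟨hV.const_smul c, fun y => ?_, fun y => ?_, fun y => ?_⟩
  · rw [norm_smul, Real.norm_eq_abs, mul_left_comm]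
    exact mul_le_mul_of_nonneg_left (hV0 y) (abs_nonneg c)
  · rw [hD, norm_smul, Real.norm_eq_abs, mul_left_comm]
    exact mul_le_mul_of_nonneg_left (hV1 y) (abs_nonneg c)
  · rw [hD, fderiv_fun_const_smul (hdD y) c, norm_smul_clm2, mul_left_comm]
    exact mul_le_mul_of_nonneg_left (hV2 y) (abs_nonneg c)

/-! ## The a-priori bound and what it gives for free: uniqueness -/

/-- **Uniform a-priori bound in the sharp scales** at base `U`, rate `α`, weight `a`, constant `B`: every `W ∈ X♯_a` (any radius),
divergence free, and `Q ∈ C¹` bounded, solving `𝓛_(α,U) W + ∇Q = F` pointwise with `F ∈ Y♯_a(R)`, satisfy `W ∈ X♯_a(B R)`.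
(Route-posited vocabulary: the ESTIMATE half of a Kelvin gate; the crux's Kelvin-mode analysis is what would supply it.) -/
def SharpApriori (a B α : ℝ) (U : EuclideanSpace ℝ (Fin 3) → EuclideanSpace ℝ (Fin 3)) : Prop :=
  ∀ (W : EuclideanSpace ℝ (Fin 3) → EuclideanSpace ℝ (Fin 3)) (Q : EuclideanSpace ℝ (Fin 3) → ℝ)
    (F : EuclideanSpace ℝ (Fin 3) → EuclideanSpace ℝ (Fin 3)) (R : ℝ),
    (∃ R', XSharp a W R') → VectorCalculus.IsDivFree W → ContDiff ℝ 1 Q → (∃ Mq, ∀ y, |Q y| ≤ Mq) →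
    YSharp a F R → (∀ y, lerayLin α U W y + gradient Q y = F y) → XSharp a W (B * R)

/-- **An a-priori bound gives uniqueness in the class**: two solutions `(W₁,Q₁)`, `(W₂,Q₂)` (sharp X-bounded, divergence free,
`C¹` bounded pressures) of `𝓛_(α,U) W + ∇Q = F` for the SAME right-hand side have `W₁ = W₂` (apply the bound to the difference,
whose datum is `0 ∈ Y♯_a(0)`). -/
theorem SharpApriori.eq_of_solutions {a B α : ℝ} {U : EuclideanSpace ℝ (Fin 3) → EuclideanSpace ℝ (Fin 3)}
    (hB : SharpApriori a B α U) {W₁ W₂ F : EuclideanSpace ℝ (Fin 3) → EuclideanSpace ℝ (Fin 3)}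
    {Q₁ Q₂ : EuclideanSpace ℝ (Fin 3) → ℝ} {R₁ R₂ M₁ M₂ : ℝ}
    (hW₁ : XSharp a W₁ R₁) (hW₂ : XSharp a W₂ R₂) (hd₁ : VectorCalculus.IsDivFree W₁) (hd₂ : VectorCalculus.IsDivFree W₂)
    (hQ₁ : ContDiff ℝ 1 Q₁) (hQ₂ : ContDiff ℝ 1 Q₂) (hM₁ : ∀ y, |Q₁ y| ≤ M₁) (hM₂ : ∀ y, |Q₂ y| ≤ M₂)
    (h₁ : ∀ y, lerayLin α U W₁ y + gradient Q₁ y = F y) (h₂ : ∀ y, lerayLin α U W₂ y + gradient Q₂ y = F y) :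
    W₁ = W₂ := by
  have hX : XSharp a (fun y => W₁ y - W₂ y) (R₁ + R₂) := hW₁.sub hW₂
  have hdiff₁ : Differentiable ℝ W₁ := hW₁.1.differentiable (by norm_num)
  have hdiff₂ : Differentiable ℝ W₂ := hW₂.1.differentiable (by norm_num)
  have hdiv : VectorCalculus.IsDivFree (fun y => W₁ y - W₂ y) := isDivFree_fun_sub hd₁ hd₂ hdiff₁ hdiff₂
  have hQ : ContDiff ℝ 1 (fun y => Q₁ y - Q₂ y) := hQ₁.sub hQ₂
  have hQb : ∃ Mq, ∀ y, |Q₁ y - Q₂ y| ≤ Mq :=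
    ⟨M₁ + M₂, fun y => (abs_sub _ _).trans (add_le_add (hM₁ y) (hM₂ y))⟩
  have heq : ∀ y, lerayLin α U (fun z => W₁ z - W₂ z) y + gradient (fun z => Q₁ z - Q₂ z) y =
      (fun _ => (0 : EuclideanSpace ℝ (Fin 3))) y := by
    intro y
    rw [lerayLin_fun_sub α U hW₁.1.contDiffAt hW₂.1.contDiffAt,
      gradient_fun_sub' ((hQ₁.differentiable (by norm_num)) y) ((hQ₂.differentiable (by norm_num)) y)]
    have e : lerayLin α U W₁ y - lerayLin α U W₂ y + (gradient Q₁ y - gradient Q₂ y) =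
        (lerayLin α U W₁ y + gradient Q₁ y) - (lerayLin α U W₂ y + gradient Q₂ y) := by abel
    rw [e, h₁ y, h₂ y, sub_self]
  have h0 : XSharp a (fun y => W₁ y - W₂ y) (B * 0) := hB _ _ _ 0 ⟨_, hX⟩ hdiv hQ hQb ySharp_zero heq
  have hzero : (fun y => W₁ y - W₂ y) = fun _ => 0 := XSharp.eq_zero_of_nonpos h0 (by simp)
  funext y
  exact sub_eq_zero.mp (congrFun hzero y)

/-! ## Monotonicity and renormalisation of sharp gates -/

/-- A sharp gate spec is monotone in its bound. -/
theorem SharpGateSpec.mono {a A A' α : ℝ} {U0 : EuclideanSpace ℝ (Fin 3) → EuclideanSpace ℝ (Fin 3)}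
    {K : (EuclideanSpace ℝ (Fin 3) → EuclideanSpace ℝ (Fin 3)) → EuclideanSpace ℝ (Fin 3) → EuclideanSpace ℝ (Fin 3)}
    {𝒬 : (EuclideanSpace ℝ (Fin 3) → EuclideanSpace ℝ (Fin 3)) → EuclideanSpace ℝ (Fin 3) → ℝ}
    (hg : SharpGateSpec a A α U0 K 𝒬) (hA : A ≤ A') : SharpGateSpec a A' α U0 K 𝒬 := by
  refine ⟨fun F R hF => ?_, hg.2⟩
  obtain ⟨hX, hdiv, hQ1, hQb, heq⟩ := hg.1 F R hF
  have hR : 0 ≤ R := hF.nonneg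
  exact ⟨hX.mono (mul_le_mul_of_nonneg_right hA hR), hdiv, hQ1,
    fun y => (hQb y).trans (mul_le_mul_of_nonneg_right hA hR), heq⟩

/-- **RENORMALISATION.**  Let `(K₀, 𝒬₀)` be a sharp gate at `U⁰` (bound `A₀`) where an a-priori bound holds (only its UNIQUENESS is
used), and let `(K′, 𝒬′)` be ANY sharp gate at `U⁰ + V′` (`V′ ∈ C²` of weighted size `M′`) where the a-priori bound `B` holds.  Then
`(K′, F ↦ 𝒬₀(F − (D(K′F)[V′] + DV′[K′F])))` is a sharp gate at `U⁰ + V′` with bound `max B (A₀(1 + 4M′B))` — independent of the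
bound `K′` came with.  (`K′F` and `K₀(F − …)` solve the same equation at `U⁰`, so they coincide; their pressures then have the same
gradient.) -/
theorem SharpGateSpec.renorm {a A₀ A' B₀ B M' α : ℝ} {U0 V' : EuclideanSpace ℝ (Fin 3) → EuclideanSpace ℝ (Fin 3)}
    {K₀ K' : (EuclideanSpace ℝ (Fin 3) → EuclideanSpace ℝ (Fin 3)) → EuclideanSpace ℝ (Fin 3) → EuclideanSpace ℝ (Fin 3)}
    {𝒬₀ 𝒬' : (EuclideanSpace ℝ (Fin 3) → EuclideanSpace ℝ (Fin 3)) → EuclideanSpace ℝ (Fin 3) → ℝ}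
    (ha2 : a ≤ 2) (hg0 : SharpGateSpec a A₀ α U0 K₀ 𝒬₀) (hap0 : SharpApriori a B₀ α U0)
    (hg' : SharpGateSpec a A' α (fun z => U0 z + V' z) K' 𝒬') (hap' : SharpApriori a B α (fun z => U0 z + V' z))
    (hU0 : Differentiable ℝ U0) (hV : ContDiff ℝ 2 V') (hV0 : ∀ y, (1 + ‖y‖) * ‖V' y‖ ≤ M')
    (hV1 : ∀ y, (1 + ‖y‖) ^ 2 * ‖fderiv ℝ V' y‖ ≤ M') (hV2 : ∀ y, (1 + ‖y‖) ^ 3 * ‖fderiv ℝ (fderiv ℝ V') y‖ ≤ M') :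
    SharpGateSpec a (max B (A₀ * (1 + 4 * M' * B))) α (fun z => U0 z + V' z) K'
      (fun F => 𝒬₀ (fun y => F y - (fderiv ℝ (K' F) y (V' y) + fderiv ℝ V' y (K' F y)))) := by
  refine ⟨fun F R hF => ?_, hg'.2⟩
  obtain ⟨hX', hdiv', hQ1', hQb', heq'⟩ := hg'.1 F R hF
  have hR : 0 ≤ R := hF.nonneg
  have hM' : 0 ≤ M' := le_trans (by positivity) (hV0 0)
  -- a-priori velocity bound at `U⁰ + V′`
  have hXB : XSharp a (K' F) (B * R) := hap' _ _ _ R ⟨_, hX'⟩ hdiv' hQ1' ⟨_, hQb'⟩ hF heq'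
  -- the effective datum at `U⁰`
  set Φ : EuclideanSpace ℝ (Fin 3) → EuclideanSpace ℝ (Fin 3) :=
    fun y => F y - (fderiv ℝ (K' F) y (V' y) + fderiv ℝ V' y (K' F y)) with hΦ
  have hP : YSharp a (fun y => fderiv ℝ (K' F) y (V' y) + fderiv ℝ V' y (K' F y)) (4 * M' * (B * R)) :=
    hXB.ySharp_perturbation ha2 hV hV0 hV1 hV2
  have hΦY : YSharp a Φ (R + 4 * M' * (B * R)) := hF.sub hP
  obtain ⟨hX0, hdiv0, hQ10, hQb0, heq0⟩ := hg0.1 Φ _ hΦY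
  -- `K′F` solves the equation at `U⁰` with datum `Φ`
  have heqU0 : ∀ y, lerayLin α U0 (K' F) y + gradient (𝒬' F) y = Φ y := by
    intro y
    have hVd : DifferentiableAt ℝ V' y := (hV.differentiable (by norm_num)) y
    have h := heq' y
    rw [lerayLin_add_base α U0 V' (K' F) y (hU0 y) hVd] at h
    rw [hΦ]
    simp only
    rw [← h]
    abel
  -- uniqueness at `U⁰`: `K′F = K₀Φ`
  have hKK : K' F = K₀ Φ := hap0.eq_of_solutions hX' hX0 hdiv' hdiv0 hQ1' hQ10 hQb' hQb0 heqU0 heq0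
  -- hence the two pressures have the same gradient
  have hgrad : ∀ y, gradient (𝒬₀ Φ) y = gradient (𝒬' F) y := by
    intro y
    have h1 := heq0 y
    have h2 := heqU0 y
    rw [← hKK] at h1
    have : lerayLin α U0 (K' F) y + gradient (𝒬₀ Φ) y = lerayLin α U0 (K' F) y + gradient (𝒬' F) y := by rw [h1, h2]
    exact add_left_cancel this
  refine ⟨hXB.mono (mul_le_mul_of_nonneg_right (le_max_left _ _) hR), hdiv', hQ10, fun y => (hQb0 y).trans ?_, fun y => ?_⟩
  · have e : A₀ * (R + 4 * M' * (B * R)) = A₀ * (1 + 4 * M' * B) * R := by ring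
    rw [e]
    exact mul_le_mul_of_nonneg_right (le_max_right _ _) hR
  · rw [hgrad y]; exact heq' y

/-! ## The continuity method -/

/-- **THE CONTINUITY METHOD IN THE SHARP SCALES.**  Let `1 ≤ a ≤ 2`, `(K₀, 𝒬₀)` a sharp gate at `U⁰` (differentiable) with bound
`A₀ ≥ 0`, `V ∈ C²` a base increment of ANY weighted size `M` (`⟨y⟩‖V‖, ⟨y⟩²‖DV‖, ⟨y⟩³‖D²V‖ ≤ M`), and suppose the UNIFORM A-PRIORI
BOUND `SharpApriori a B α (U⁰ + tV)` holds for every `t ∈ [0,1]` (`B ≥ 0`).  Then there is a sharp Kelvin gate at `U⁰ + V` with bound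
`max B (A₀ (1 + 4 M B))`.  (Proof: `n = ⌈8A⋆M⌉₊ + 1` steps of `SharpGateSpec.perturb` with increment `V/n`, `A⋆ := max B (A₀(1+4MB))`,
each followed by `SharpGateSpec.renorm`; the bound never leaves `A⋆`.) -/
theorem sharp_gate_continuation {a A₀ B M α : ℝ} {U0 V : EuclideanSpace ℝ (Fin 3) → EuclideanSpace ℝ (Fin 3)}
    {K₀ : (EuclideanSpace ℝ (Fin 3) → EuclideanSpace ℝ (Fin 3)) → EuclideanSpace ℝ (Fin 3) → EuclideanSpace ℝ (Fin 3)}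
    {𝒬₀ : (EuclideanSpace ℝ (Fin 3) → EuclideanSpace ℝ (Fin 3)) → EuclideanSpace ℝ (Fin 3) → ℝ}
    (ha1 : 1 ≤ a) (ha2 : a ≤ 2) (hg0 : SharpGateSpec a A₀ α U0 K₀ 𝒬₀) (hA₀ : 0 ≤ A₀) (hB : 0 ≤ B)
    (hU0 : Differentiable ℝ U0) (hV : ContDiff ℝ 2 V) (hV0 : ∀ y, (1 + ‖y‖) * ‖V y‖ ≤ M)
    (hV1 : ∀ y, (1 + ‖y‖) ^ 2 * ‖fderiv ℝ V y‖ ≤ M) (hV2 : ∀ y, (1 + ‖y‖) ^ 3 * ‖fderiv ℝ (fderiv ℝ V) y‖ ≤ M)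
    (hap : ∀ t ∈ Set.Icc (0:ℝ) 1, SharpApriori a B α (fun z => U0 z + t • V z)) :
    ∃ (K : (EuclideanSpace ℝ (Fin 3) → EuclideanSpace ℝ (Fin 3)) → EuclideanSpace ℝ (Fin 3) → EuclideanSpace ℝ (Fin 3))
      (𝒬 : (EuclideanSpace ℝ (Fin 3) → EuclideanSpace ℝ (Fin 3)) → EuclideanSpace ℝ (Fin 3) → ℝ),
      SharpGateSpec a (max B (A₀ * (1 + 4 * M * B))) α (fun z => U0 z + V z) K 𝒬 := by
  set As : ℝ := max B (A₀ * (1 + 4 * M * B)) with hAs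
  have hM : 0 ≤ M := le_trans (by positivity) (hV0 0)
  have hAs0 : 0 ≤ As := le_trans hB (le_max_left _ _)
  have hVd : Differentiable ℝ V := hV.differentiable (by norm_num)
  -- the a-priori bound at the origin of the path (uniqueness at `U⁰`)
  have hap0 : SharpApriori a B α U0 := by
    have h := hap 0 ⟨le_refl _, zero_le_one⟩
    have e : (fun z => U0 z + (0:ℝ) • V z) = U0 := by funext z; simp
    rwa [e] at h
  -- number of steps
  set n : ℕ := ⌈8 * As * M⌉₊ + 1 with hn
  have hn0 : 0 < n := Nat.succ_pos _
  have hnR : (0:ℝ) < n := by exact_mod_cast hn0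
  have hnAs : 8 * As * M ≤ (n:ℝ) := by
    have h1 : 8 * As * M ≤ (⌈8 * As * M⌉₊ : ℝ) := Nat.le_ceil _
    have h2 : ((⌈8 * As * M⌉₊ : ℕ) : ℝ) ≤ (n : ℝ) := by rw [hn]; push_cast; linarith
    exact h1.trans h2
  have hstep : 8 * As * (|1 / (n:ℝ)| * M) ≤ 1 := by
    rw [abs_of_pos (by positivity : (0:ℝ) < 1 / n)]
    rw [show 8 * As * (1 / (n:ℝ) * M) = (8 * As * M) / n by ring, div_le_one hnR]
    exact hnAs
  -- the induction along the path `U_i = U⁰ + (i/n) V`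
  have key : ∀ i : ℕ, i ≤ n →
      ∃ (K : (EuclideanSpace ℝ (Fin 3) → EuclideanSpace ℝ (Fin 3)) → EuclideanSpace ℝ (Fin 3) → EuclideanSpace ℝ (Fin 3))
        (𝒬 : (EuclideanSpace ℝ (Fin 3) → EuclideanSpace ℝ (Fin 3)) → EuclideanSpace ℝ (Fin 3) → ℝ),
        SharpGateSpec a As α (fun z => U0 z + ((i:ℝ) / n) • V z) K 𝒬 := by
    intro i
    induction i with
    | zero =>
      intro _
      have e : (fun z => U0 z + (((0:ℕ):ℝ) / n) • V z) = U0 := by funext z; simp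
      rw [e]
      refine ⟨K₀, 𝒬₀, hg0.mono ?_⟩
      have h1 : A₀ ≤ A₀ * (1 + 4 * M * B) := by
        have : (1:ℝ) ≤ 1 + 4 * M * B := by nlinarith
        nlinarith
      exact h1.trans (le_max_right _ _)
    | succ i ih =>
      intro hi
      obtain ⟨K, 𝒬, hg⟩ := ih (Nat.le_of_succ_le hi)
      -- differentiability of the current base
      have hUi : Differentiable ℝ (fun z => U0 z + ((i:ℝ) / n) • V z) :=
        hU0.add ((baseIncrement_smul hV hV0 hV1 hV2 ((i:ℝ) / n)).1.differentiable (by norm_num))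
      -- the increment `V / n`
      obtain ⟨hWc, hW0, hW1, hW2⟩ := baseIncrement_smul hV hV0 hV1 hV2 (1 / (n:ℝ))
      obtain ⟨K', hg'⟩ := hg.perturb ha1 ha2 hUi hWc hW0 hW1 hW2 hstep
      -- the new base is `U⁰ + ((i+1)/n) V`
      have epath : (fun z => (U0 z + ((i:ℝ) / n) • V z) + (1 / (n:ℝ)) • V z) =
          fun z => U0 z + ((((i + 1 : ℕ) : ℝ)) / n) • V z := by
        funext z
        push_cast
        rw [add_div, add_smul]
        abel
      rw [epath] at hg'
      -- renormalise at `U⁰ + V'`, `V' = ((i+1)/n) V`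
      obtain ⟨hVc', hV0', hV1', hV2'⟩ := baseIncrement_smul hV hV0 hV1 hV2 ((((i + 1 : ℕ) : ℝ)) / n)
      have ht : ((((i + 1 : ℕ) : ℝ)) / n) ∈ Set.Icc (0:ℝ) 1 := by
        refine ⟨by positivity, ?_⟩
        rw [div_le_one hnR]
        exact_mod_cast hi
      have hren := SharpGateSpec.renorm (V' := fun z => ((((i + 1 : ℕ) : ℝ)) / n) • V z) ha2 hg0 hap0 hg'
        (hap _ ht) hU0 hVc' hV0' hV1' hV2'
      refine ⟨K', _, hren.mono (max_le_max le_rfl ?_)⟩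
      -- `A₀ (1 + 4 (t M) B) ≤ A₀ (1 + 4 M B)` for `t = (i+1)/n ≤ 1`
      have htabs : |((((i + 1 : ℕ) : ℝ)) / n)| ≤ 1 := by
        rw [abs_of_nonneg ht.1]; exact ht.2
      have h1 : |((((i + 1 : ℕ) : ℝ)) / n)| * M ≤ M := by
        calc |((((i + 1 : ℕ) : ℝ)) / n)| * M ≤ 1 * M := mul_le_mul_of_nonneg_right htabs hM
          _ = M := one_mul M
      have h2 : 1 + 4 * (|((((i + 1 : ℕ) : ℝ)) / n)| * M) * B ≤ 1 + 4 * M * B := by nlinarith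
      exact mul_le_mul_of_nonneg_left h2 hA₀
  obtain ⟨K, 𝒬, hK⟩ := key n le_rfl
  have e : (fun z => U0 z + ((n:ℝ) / n) • V z) = fun z => U0 z + V z := by funext z; rw [div_self hnR.ne', one_smul]
  exact ⟨K, 𝒬, e ▸ hK⟩

/-- **A SHARP KELVIN GATE AT EVERY BASE WITH A UNIFORM A-PRIORI BOUND ALONG ITS RAY.**  For `1 < a < 2` there is `C = C(a) ≥ 0`
(the free gate's constant) such that: for every rate `α`, every `C²` base `V` of weighted size `M` (any size), and every `B ≥ 0` with
`SharpApriori a B α (tV)` for all `t ∈ [0,1]`, there is a sharp Kelvin gate at `V` with bound `max B (C (1 + 4 M B))`.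
In words: in the sharp scales the EXISTENCE of the gate at a large base is equivalent-in-practice to the uniform a-priori ESTIMATE
along the ray — polynomial losses preserved.  (Free gate `sharpGateSpec_free` + `sharp_gate_continuation`.) -/
theorem sharp_gate_of_apriori {a : ℝ} (ha1 : 1 < a) (ha2 : a < 2) :
    ∃ C : ℝ, 0 ≤ C ∧ ∀ (α B M : ℝ) (V : EuclideanSpace ℝ (Fin 3) → EuclideanSpace ℝ (Fin 3)), 0 ≤ B →
      ContDiff ℝ 2 V → (∀ y, (1 + ‖y‖) * ‖V y‖ ≤ M) → (∀ y, (1 + ‖y‖) ^ 2 * ‖fderiv ℝ V y‖ ≤ M) →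
      (∀ y, (1 + ‖y‖) ^ 3 * ‖fderiv ℝ (fderiv ℝ V) y‖ ≤ M) →
      (∀ t ∈ Set.Icc (0:ℝ) 1, SharpApriori a B α (fun z => t • V z)) →
      ∃ (K : (EuclideanSpace ℝ (Fin 3) → EuclideanSpace ℝ (Fin 3)) → EuclideanSpace ℝ (Fin 3) → EuclideanSpace ℝ (Fin 3))
        (𝒬 : (EuclideanSpace ℝ (Fin 3) → EuclideanSpace ℝ (Fin 3)) → EuclideanSpace ℝ (Fin 3) → ℝ),
        SharpGateSpec a (max B (C * (1 + 4 * M * B))) α V K 𝒬 := by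
  obtain ⟨C, hC0, hfree⟩ := sharpGateSpec_free ha1 ha2
  refine ⟨C, hC0, fun α B M V hB hV hV0 hV1 hV2 hap => ?_⟩
  have hap' : ∀ t ∈ Set.Icc (0:ℝ) 1, SharpApriori a B α (fun z => (fun _ => (0 : EuclideanSpace ℝ (Fin 3))) z + t • V z) := by
    intro t ht
    have e : (fun z => (fun _ => (0 : EuclideanSpace ℝ (Fin 3))) z + t • V z) = fun z => t • V z := by
      funext z; simp
    rw [e]; exact hap t ht
  obtain ⟨K, 𝒬, hK⟩ := sharp_gate_continuation ha1.le ha2.le (hfree α) hC0 hB (differentiable_const _) hV hV0 hV1 hV2 hap'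
  have e : (fun z => (fun _ => (0 : EuclideanSpace ℝ (Fin 3))) z + V z) = V := by funext z; simp
  exact ⟨K, 𝒬, e ▸ hK⟩

/-- **Conversely (sanity): a sharp gate plus uniqueness IS an a-priori bound.**  If `(K, 𝒬)` is a sharp gate at `U` with bound `A`
and solutions in the class are unique at `U` (e.g. from any a-priori bound there), then `SharpApriori a A α U`.  So along a ray the
a-priori bound is exactly «gate bound + uniqueness», uniformly in `t`. -/
theorem SharpGateSpec.apriori_of_unique {a A B₀ α : ℝ} {U : EuclideanSpace ℝ (Fin 3) → EuclideanSpace ℝ (Fin 3)}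
    {K : (EuclideanSpace ℝ (Fin 3) → EuclideanSpace ℝ (Fin 3)) → EuclideanSpace ℝ (Fin 3) → EuclideanSpace ℝ (Fin 3)}
    {𝒬 : (EuclideanSpace ℝ (Fin 3) → EuclideanSpace ℝ (Fin 3)) → EuclideanSpace ℝ (Fin 3) → ℝ}
    (hg : SharpGateSpec a A α U K 𝒬) (huniq : SharpApriori a B₀ α U) : SharpApriori a A α U := by
  intro W Q F R hW hdiv hQ hQb hF heq
  obtain ⟨R', hW'⟩ := hW
  obtain ⟨Mq, hMq⟩ := hQb
  obtain ⟨hX, hdivK, hQ1, hQbK, heqK⟩ := hg.1 F R hF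
  have hWK : W = K F := huniq.eq_of_solutions hW' hX hdiv hdivK hQ hQ1 hMq hQbK heq heqK
  rw [hWK]; exact hX

end Summit.NavierStokesRegularity.NavierStokesRegularity.Theorems.KelvinGate

end
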